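import Summits.CriticalPhenomena.PercolationContinuityZ3.Theorems.Transplant.PlanarDirConeCentre
import HarnessLib

/-!
# WEIGHTED CONES of `ℤ³` around a COORDINATE-PLANE direction — VI: the GREEDY SCHEDULE (centring moves, then raise moves) up to the station
# `⌈Rv⌉ = (⌈Rv₀⌉, ⌈Rv₁⌉, 0)` (fourth file of the uniqueness column for `v = (v₀, v₁, 0)`)

builds on p205010 (kernel theorem, internal audit signed; external expert review pending) — NOT used in this file.
Lane `prim-bschramm`, seat `prim-bschramm-p2` (gen 30; class C1b, METHOD = input substitution; memo `HOME/bschramm/P2-LATTICES.md` §107);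
helper file (`--supports stmt-CriticalPhenomena-4575 --as helper`) for ROW N6 of TABLE v44 (directions with exactly one vanishing coordinate).

THE SCHEDULE.  The invariant is `WCone.Inv` (in `𝕂`, slack `kK`, `H > N`, `Pⱼ ≤ ⌈Rvⱼ⌉` — for `j = 2` this reads `P₂ ≤ 0` since `v₂ = 0`) and the
potential is `WCone.pot` (`Ψ = Σⱼ[(⌈Rvⱼ⌉ − Pⱼ) + A·𝟙(Pⱼ < ⌈Rvⱼ⌉)]`, the `j = 2` term being `|P₂| + A·𝟙(P₂ < 0)`).  One step (`step₀`): if `P₂ < 0`,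
a CENTRING move `P → P + a e₂`, `a = min(A, −P₂)` (`PlanarDirConeCentre.centre_datum`, spread along the positive coordinate of minimal ratio);
if `P₂ = 0`, a RAISE move of the open positive coordinate of minimal ratio (`PlanarDirConeMove.raise_datum₂`; the other positive coordinate, open
or closed, has larger ratio — `low_pair₀`).  Either move lowers `Ψ` by `≥ A` and keeps the invariant (`inv_centre`, `inv_raise₀`); **`schedule₀`**:
`Ψ(P) < (n+1)A` ⇒ `n` moves reach `⌈Rv⌉` with probability `(α₂α²)ⁿ` and `n·k` extra edges.
[cite: AizenmanChayesChayesFrohlichRusso1983, §4 Cor. to Lemma 4.3, Lemma 4.2 (a)] [cite: GrimmettPercolation1999, Thm. (2.4)] -/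

noncomputable section

namespace Summit.CriticalPhenomena.PercolationContinuityZ3.Theorems.Transplant

namespace PWCone

open MeasureTheory Literature.Probability.Percolation Literature.Probability.LatticeModels SimpleGraph HSU OrthantUniq HalfSlabUniq
  TubeSlabUniq DesignTransport WallUniq DiagCone SectorSlab ConeSlabUniq WCone Filter
open scoped Classical

/-! ## §1 Frames, the window, the invariant under the two moves -/

/-- The four frames used (values of `π 0, π 1, π 2`): raise frames `(2,0,1)`, `(2,1,0)`; centring frames `(1,2,0)`, `(0,2,1)`. [folklore] -/
theorem frames₀ : ((Equiv.swap (0 : Fin 3) 1 * Equiv.swap 0 2 : Equiv.Perm (Fin 3)) 0 = 2 ∧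
      (Equiv.swap (0 : Fin 3) 1 * Equiv.swap 0 2 : Equiv.Perm (Fin 3)) 1 = 0 ∧ (Equiv.swap (0 : Fin 3) 1 * Equiv.swap 0 2 : Equiv.Perm (Fin 3)) 2 = 1) ∧
    ((Equiv.swap (0 : Fin 3) 2) 0 = 2 ∧ (Equiv.swap (0 : Fin 3) 2) 1 = 1 ∧ (Equiv.swap (0 : Fin 3) 2) 2 = 0) ∧
    ((Equiv.swap (0 : Fin 3) 1 * Equiv.swap 1 2 : Equiv.Perm (Fin 3)) 0 = 1 ∧ (Equiv.swap (0 : Fin 3) 1 * Equiv.swap 1 2 : Equiv.Perm (Fin 3)) 1 = 2 ∧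
      (Equiv.swap (0 : Fin 3) 1 * Equiv.swap 1 2 : Equiv.Perm (Fin 3)) 2 = 0) ∧
    ((Equiv.swap (1 : Fin 3) 2) 0 = 0 ∧ (Equiv.swap (1 : Fin 3) 2) 1 = 2 ∧ (Equiv.swap (1 : Fin 3) 2) 2 = 1) := by decide

/-- The window constant of the invariant points: `Q_R = B_{⌈3K(RK+1)⌉}` (height `≤ Σ vⱼ⌈Rvⱼ⌉ ≤ 3K(RK+1)`, then the box of that height). [folklore] -/
def winQ₀ (v : Fin 3 → ℝ) (τ K R : ℝ) : ℕ := WCone.boxR v τ K ⌈3 * K * (R * K + 1)⌉₊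

section Cone

variable {v : Fin 3 → ℝ} {κ K τ h : ℝ} (hv2 : v 2 = 0) (hκ : 0 < κ) (hv0 : κ ≤ v 0) (hv1 : κ ≤ v 1) (hvK : ∀ i, v i ≤ K) (hτ : 0 < τ)
  (hh : K ≤ τ * h) {D : Set (Site 3)} (hCD : ∀ x : Site 3, x ∈ D ↔ h ≤ hgt v x ∧ ∀ i j : Fin 3, dev v x i j ≤ τ * hgt v x)
  {k : ℕ}

include hv2 in
/-- With `v₂ = 0` the station has `x₂ = 0`: `⌈Rv⌉₂ = 0`. [folklore] -/
theorem tgt_two (R : ℝ) : tgt v R 2 = 0 := by rw [tgt_apply, hv2, mul_zero, Int.ceil_zero]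

include hv2 hκ hv0 hv1 hvK hτ hh hCD in
/-- The height and the coordinates of an invariant point are bounded: `H(P) ≤ 3K(RK+1)` and `|Pⱼ| ≤ Q_R` (`R ≥ 0`). [folklore] -/
theorem inv_window₀ {N : ℕ} {R : ℝ} (hR0 : 0 ≤ R) {P : Site 3} (hI : Inv D v τ K k N R P) :
    hgt v P ≤ 3 * K * (R * K + 1) ∧ ∀ j, |P j| ≤ (winQ₀ v τ K R : ℤ) := by
  obtain ⟨hP, -, -, hM⟩ := hI
  obtain ⟨hvn, -, -, -⟩ := v_facts hv2 hκ hv0 hv1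
  obtain ⟨hK, -, -⟩ := consts₀ hv2 hκ hv0 hv1 hvK hτ hh
  have hRK : 0 ≤ R * K + 1 := by positivity
  have hc : ∀ j, (P j : ℝ) ≤ R * K + 1 := fun j => by
    have h1 : ((P j : ℤ) : ℝ) ≤ ((⌈R * v j⌉ : ℤ) : ℝ) := by exact_mod_cast hM j
    have h2 : ((⌈R * v j⌉ : ℤ) : ℝ) < R * v j + 1 := Int.ceil_lt_add_one _
    have h3 : R * v j ≤ R * K := mul_le_mul_of_nonneg_left (hvK j) hR0
    linarith
  have hS : hgt v P ≤ 3 * K * (R * K + 1) := by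
    have e : ∀ j, v j * (P j : ℝ) ≤ K * (R * K + 1) := fun j =>
      (mul_le_mul_of_nonneg_left (hc j) (hvn j)).trans (mul_le_mul_of_nonneg_right (hvK j) hRK)
    unfold hgt; linarith [e 0, e 1, e 2]
  refine ⟨hS, fun j => ?_⟩
  have hmem := (box_facts₀ hv2 hκ hv0 hv1 hvK hτ hh hCD).2 ⌈3 * K * (R * K + 1)⌉₊ P hP
    (by have := Nat.le_ceil (3 * K * (R * K + 1)); linarith)
  have := (mem_boxSet_iff.1 hmem) j
  unfold winQ₀; exact abs_le.2 this

include hv2 hκ hv0 hv1 in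
/-- **A centring move keeps the invariant**: `P₂ + a ≤ 0`, `P' = P + a e₂ ∈ 𝕂` ⇒ `Inv P'` (the terms `vⱼP₂'` are `≤ 0`, `−vⱼP₂'` decrease, the
height and the positive coordinates are unchanged). [folklore] -/
theorem inv_centre {N : ℕ} {R : ℝ} {P : Site 3} (hI : Inv D v τ K k N R P) {a : ℕ} (ha2 : P 2 + a ≤ 0)
    (hmemD : P + (a : ℤ) • (Pi.single 2 1 : Site 3) ∈ D) : Inv D v τ K k N R (P + (a : ℤ) • (Pi.single 2 1 : Site 3)) := by
  obtain ⟨-, hslack, hN, hM⟩ := hI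
  obtain ⟨hvn, -, -, -⟩ := v_facts hv2 hκ hv0 hv1
  obtain ⟨hH, hdev⟩ := raise_hgt_dev v P 2 (a : ℤ)
  push_cast at hH hdev; rw [hv2, mul_zero, add_zero] at hH
  have ha0 : (0 : ℝ) ≤ a := by positivity
  have ha2r : ((P 2 : ℤ) : ℝ) + a ≤ 0 := by exact_mod_cast ha2
  refine ⟨hmemD, fun i j => ?_, by rw [hH]; exact hN, fun j => ?_⟩
  · rw [hH, hdev i j]
    have hs := hslack i j
    have h00 := hslack 0 0; rw [dev_self] at h00
    by_cases hi : i = 2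
    · by_cases hj : j = 2
      · rw [if_pos hi, if_pos hj, hi, hj, dev_self]; linarith
      · rw [if_pos hi, if_neg hj, hi]
        have e : dev v P 2 j = v j * (P 2 : ℝ) := by unfold dev; rw [hv2]; ring
        rw [e]
        have : v j * (((P 2 : ℤ) : ℝ) + a) ≤ 0 := mul_nonpos_of_nonneg_of_nonpos (hvn j) ha2r
        nlinarith [hvn j]
    · rw [if_neg hi]
      by_cases hj : j = 2
      · rw [if_pos hj]; have : 0 ≤ (a : ℝ) * v i := mul_nonneg ha0 (hvn i); linarith
      · rw [if_neg hj]; linarith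
  · rw [raise_apply]
    by_cases hj : j = 2
    · rw [if_pos hj, hj, tgt_two hv2]; exact ha2
    · rw [if_neg hj, add_zero]; exact hM j

include hv2 hκ hv0 hv1 hvK hτ in
/-- **A raise move keeps the invariant** (`π0 = 2`, `D_{π1,π2}(P) ≤ 0`, `a ≤ A`, `P_{π1} + a ≤ ⌈Rv_{π1}⌉`, cap `(A + k)K ≤ τN`): the new terms
`D_{π1,π2} ≤ aK ≤ AK` are paid by `τH > τN`, `D_{π1,2}` is unchanged (`v₂ = 0`), the others only improve. [folklore] -/
theorem inv_raise₀ {N : ℕ} {R : ℝ} {Acap : ℕ} (hcap : ((Acap : ℝ) + k) * K ≤ τ * N) {P : Site 3} (hI : Inv D v τ K k N R P)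
    (π : Equiv.Perm (Fin 3)) (hπ : π 0 = 2) (hlo : dev v P (π 1) (π 2) ≤ 0) {a : ℕ} (haA : a ≤ Acap)
    (haM : P (π 1) + a ≤ tgt v R (π 1)) (hmemD : P + (a : ℤ) • (Pi.single (π 1) 1 : Site 3) ∈ D) :
    Inv D v τ K k N R (P + (a : ℤ) • (Pi.single (π 1) 1 : Site 3)) := by
  obtain ⟨-, hslack, hN, hM⟩ := hI
  obtain ⟨hvn, -, -, -⟩ := v_facts hv2 hκ hv0 hv1
  obtain ⟨hH, hdev⟩ := raise_hgt_dev v P (π 1) (a : ℤ)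
  push_cast at hH hdev
  have ha0 : (0 : ℝ) ≤ a := by positivity
  have haA' : (a : ℝ) ≤ Acap := by exact_mod_cast haA
  have hav : 0 ≤ (a : ℝ) * v (π 1) := mul_nonneg ha0 (hvn _)
  have hK0 : 0 ≤ K := (hvn 0).trans (hvK 0)
  have hπ1 : π 1 ≠ 2 := fun h => by have := π.injective (h.trans hπ.symm); exact absurd this (by decide)
  have hπ2 : π 2 ≠ 2 := fun h => by have := π.injective (h.trans hπ.symm); exact absurd this (by decide)
  refine ⟨hmemD, fun i j => ?_, by rw [hH]; linarith, fun j => ?_⟩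
  · rw [hH, hdev i j]
    have hs := hslack i j
    have hτN : τ * (N : ℝ) ≤ τ * hgt v P := mul_le_mul_of_nonneg_left hN.le hτ.le
    have hτa : 0 ≤ τ * ((a : ℝ) * v (π 1)) := mul_nonneg hτ.le hav
    by_cases hi : i = π 1
    · by_cases hj : j = π 1
      · rw [if_pos hi, if_pos hj, hi, hj, dev_self]
        have h0 := hslack (π 1) (π 1); rw [dev_self] at h0; linarith
      · rw [if_pos hi, if_neg hj, hi]
        -- `j = 2 = π 0` (unchanged term) or `j = π 2` (the other positive coordinate)
        by_cases hj2 : j = 2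
        · rw [hj2, hv2, mul_zero]
          have h22 := hslack (π 1) 2
          linarith
        · have hjπ : j = π 2 := by
            obtain ⟨q, rfl⟩ := π.surjective j
            fin_cases q
            · exact absurd hπ (by simpa using hj2)
            · simp at hj
            · rfl
          rw [hjπ]
          have h2 : (a : ℝ) * v (π 2) ≤ Acap * K := mul_le_mul haA' (hvK _) (hvn _) (by positivity)
          linarith
    · rw [if_neg hi]
      by_cases hj : j = π 1
      · rw [if_pos hj]; have : 0 ≤ (a : ℝ) * v i := mul_nonneg ha0 (hvn i); linarith
      · rw [if_neg hj]; linarith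
  · rw [raise_apply]
    by_cases hj : j = π 1
    · rw [if_pos hj, hj]; exact haM
    · rw [if_neg hj, add_zero]; exact hM j

include hv2 hκ hv0 hv1 in
/-- **The smaller-ratio positive coordinate against the other one.**  For `i ≠ j` positive coordinates with `Pⱼ ≤ ⌈Rvⱼ⌉`, `Pᵢ < ⌈Rvᵢ⌉`, and
`Pᵢ/vᵢ ≤ Pⱼ/vⱼ` unless `j` is closed (`Pⱼ = ⌈Rvⱼ⌉`): `D_{ij}(P) ≤ 0` (closed `j`: `Pᵢ ≤ ⌈Rvᵢ⌉ − 1 < Rvᵢ`, `Pⱼ ≥ Rvⱼ`). [folklore] -/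
theorem low_pair₀ {P : Site 3} {R : ℝ} {i j : Fin 3} (hi2 : i ≠ 2) (hj2 : j ≠ 2) (hjle : P j ≤ tgt v R j) (hi : P i < tgt v R i)
    (hmin : P j < tgt v R j → (P i : ℝ) / v i ≤ (P j : ℝ) / v j) : dev v P i j ≤ 0 := by
  obtain ⟨-, hκi, -, -⟩ := v_facts hv2 hκ hv0 hv1
  have hvi : 0 < v i := hκ.trans_le (hκi i hi2); have hvj : 0 < v j := hκ.trans_le (hκi j hj2)
  unfold dev
  by_cases hj : P j < tgt v R j
  · have h1 := hmin hj
    rw [div_le_div_iff₀ hvi hvj] at h1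
    linarith
  · have hPj : P j = ⌈R * v j⌉ := by rw [tgt_apply] at hjle hj; omega
    have hPi : P i ≤ ⌈R * v i⌉ - 1 := by rw [tgt_apply] at hi; omega
    have r1 : (P i : ℝ) < R * v i := by
      have h1 : ((P i : ℤ) : ℝ) ≤ ((⌈R * v i⌉ - 1 : ℤ) : ℝ) := by exact_mod_cast hPi
      have h2 : ((⌈R * v i⌉ : ℤ) : ℝ) < R * v i + 1 := Int.ceil_lt_add_one _
      push_cast at h1; linarith
    have r2 : R * v j ≤ (P j : ℝ) := by rw [hPj]; exact Int.le_ceil _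
    nlinarith [mul_lt_mul_of_pos_left r1 hvj, mul_le_mul_of_nonneg_left r2 hvi.le]

include hv2 hκ hv0 hv1 in
/-- **The centring frame**: for every `P` there is `π` with `π1 = 2` and `D_{π2,π0}(P) ≤ 0` (spread along the positive coordinate of smaller ratio).
[folklore] -/
theorem exists_cframe (P : Site 3) : ∃ π : Equiv.Perm (Fin 3), π 1 = 2 ∧ dev v P (π 2) (π 0) ≤ 0 := by
  obtain ⟨-, -, h0, h1⟩ := v_facts hv2 hκ hv0 hv1
  obtain ⟨-, -, vE, vF⟩ := frames₀
  rcases le_total ((P 0 : ℝ) / v 0) ((P 1 : ℝ) / v 1) with h01 | h10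
  · refine ⟨Equiv.swap 0 1 * Equiv.swap 1 2, vE.2.1, ?_⟩
    rw [vE.2.2, vE.1]; rw [div_le_div_iff₀ h0 h1] at h01; unfold dev; linarith
  · refine ⟨Equiv.swap 1 2, vF.2.1, ?_⟩
    rw [vF.2.2, vF.1]; rw [div_le_div_iff₀ h1 h0] at h10; unfold dev; linarith

include hv2 hκ hv0 hv1 in
/-- **The raise frame**: if `Pⱼ ≤ ⌈Rvⱼ⌉` for all `j`, `P₂ = 0` and `P ≠ ⌈Rv⌉`, there is `π` with `π0 = 2`, `P_{π1} < ⌈Rv_{π1}⌉` (open) and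
`D_{π1,π2}(P) ≤ 0`. [folklore] -/
theorem exists_rframe {P : Site 3} {R : ℝ} (hle : ∀ j, P j ≤ tgt v R j) (hP2 : P 2 = 0) (hne : P ≠ tgt v R) :
    ∃ π : Equiv.Perm (Fin 3), π 0 = 2 ∧ dev v P (π 1) (π 2) ≤ 0 ∧ P (π 1) < tgt v R (π 1) := by
  obtain ⟨vG, vC, -, -⟩ := frames₀
  have hopen : P 0 < tgt v R 0 ∨ P 1 < tgt v R 1 := by
    by_contra hcl
    push Not at hcl
    apply hne
    funext j; fin_cases j
    · exact le_antisymm (hle 0) hcl.1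
    · exact le_antisymm (hle 1) hcl.2
    · show P 2 = tgt v R 2; rw [hP2, tgt_two hv2]
  -- frame with `π1 = 0`: `swap 0 1 * swap 0 2`; with `π1 = 1`: `swap 0 2`
  have use0 : P 0 < tgt v R 0 → (P 1 < tgt v R 1 → (P 0 : ℝ) / v 0 ≤ (P 1 : ℝ) / v 1) →
      ∃ π : Equiv.Perm (Fin 3), π 0 = 2 ∧ dev v P (π 1) (π 2) ≤ 0 ∧ P (π 1) < tgt v R (π 1) := fun h0 hmin =>
    ⟨Equiv.swap 0 1 * Equiv.swap 0 2, vG.1, by rw [vG.2.1, vG.2.2]; exact low_pair₀ hv2 hκ hv0 hv1 (by decide) (by decide) (hle 1) h0 hmin,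
      by rw [vG.2.1]; exact h0⟩
  have use1 : P 1 < tgt v R 1 → (P 0 < tgt v R 0 → (P 1 : ℝ) / v 1 ≤ (P 0 : ℝ) / v 0) →
      ∃ π : Equiv.Perm (Fin 3), π 0 = 2 ∧ dev v P (π 1) (π 2) ≤ 0 ∧ P (π 1) < tgt v R (π 1) := fun h1 hmin =>
    ⟨Equiv.swap 0 2, vC.1, by rw [vC.2.1, vC.2.2]; exact low_pair₀ hv2 hκ hv0 hv1 (by decide) (by decide) (hle 0) h1 hmin,
      by rw [vC.2.1]; exact h1⟩
  rcases le_total ((P 0 : ℝ) / v 0) ((P 1 : ℝ) / v 1) with h01 | h10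
  · rcases hopen with h0 | h1
    · exact use0 h0 fun _ => h01
    · by_cases h0 : P 0 < tgt v R 0
      · exact use0 h0 fun _ => h01
      · exact use1 h1 fun h0' => absurd h0' h0
  · rcases hopen with h0 | h1
    · by_cases h1 : P 1 < tgt v R 1
      · exact use1 h1 fun _ => h10
      · exact use0 h0 fun h1' => absurd h1' h1
    · exact use1 h1 fun _ => h10

/-! ## §2 One step and the schedule -/

include hv2 hκ hv0 hv1 hvK hτ hh hCD in
/-- **ONE STEP OF THE SCHEDULE.**  With an arm kit `A`, thin-arm bound `α₂` (`m ≥ 1`, `K ≤ mκ`), `R ≥ 0`, `A ≥ 1`, caps `(A + k)K ≤ τN`,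
`K(2A + 3) ≤ τN` and window `Mw ≥ 2A + 3 + k + Q_R`: an invariant `P ≠ ⌈Rv⌉` admits a datum `P → P'` (`k` edges, probability `α₂α²`) to an invariant
`P'` with `Ψ(P') + A ≤ Ψ(P)` — a centring move if `P₂ < 0`, a raise move if `P₂ = 0`. [cite: AizenmanChayesChayesFrohlichRusso1983, §4 Lemma 4.3] -/
theorem step₀ {N : ℕ} {Λ : Set (Site 3)} (hΛ : ∀ x ∈ Λ, hgt v x ≤ (N : ℝ)) {p' : unitInterval} (A : SlabArmKit k p')
    {m : ℕ} (hm : 1 ≤ m) (hmK : K ≤ (m : ℝ) * κ) {α₂ : ℝ} (hα₂ : 0 < α₂)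
    (harm : ∀ b : Site 3, b ∈ slab 3 k →
      α₂ ≤ (bondPercolation (zdGraph 3) p').real (percolatesVia (withinGraph (zdGraph 3) (steepSetM (2 * m) k 1 b)) b))
    {R : ℝ} (hR0 : 0 ≤ R) {Acap Mw : ℕ} (hA1 : 1 ≤ Acap) (hcapS : ((Acap : ℝ) + k) * K ≤ τ * N)
    (hcapT : K * (2 * (Acap : ℝ) + 3) ≤ τ * N) (hMw : 2 * Acap + 3 + k + winQ₀ v τ K R ≤ Mw) {P : Site 3} (hI : Inv D v τ K k N R P)
    (hne : P ≠ tgt v R) :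
    ∃ P' : Site 3, Datum D Λ p' Mw (α₂ * A.α ^ 2) k P P' ∧ Inv D v τ K k N R P' ∧ pot v R Acap P' + Acap ≤ pot v R Acap P := by
  obtain ⟨hP, hslack, hN, hM⟩ := hI
  obtain ⟨hK, -, -⟩ := consts₀ hv2 hκ hv0 hv1 hvK hτ hh
  obtain ⟨hvn, -, -, -⟩ := v_facts hv2 hκ hv0 hv1
  have hq1 : α₂ ≤ 1 := (harm 0 (zero_mem_slab 3 k)).trans measureReal_le_one
  have hqa : A.α ≤ 1 := (A.shallow_arm 0 (zero_mem_slab 3 k)).trans measureReal_le_one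
  have hα0 := A.α_pos
  have hqc : α₂ * A.α ^ 2 ≤ A.α ^ 2 := mul_le_of_le_one_left (sq_nonneg _) hq1
  have hαα : A.α ^ 2 ≤ A.α := by nlinarith
  have hqr : α₂ * A.α ^ 2 ≤ α₂ * A.α := mul_le_mul_of_nonneg_left hαα hα₂.le
  have hτN : τ * (N : ℝ) ≤ τ * hgt v P := mul_le_mul_of_nonneg_left hN.le hτ.le
  have hQ := (inv_window₀ hv2 hκ hv0 hv1 hvK hτ hh hCD hR0 ⟨hP, hslack, hN, hM⟩).2
  have ht2 := tgt_two (v := v) hv2 R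
  by_cases hP2 : P 2 < 0
  · -- CENTRING MOVE
    obtain ⟨π, hπ, hlo⟩ := exists_cframe hv2 hκ hv0 hv1 P
    set a : ℕ := min Acap (-P 2).toNat with ha_def
    have hgap : ((-P 2).toNat : ℤ) = -P 2 := Int.toNat_of_nonneg (by omega)
    have haA : a ≤ Acap := min_le_left _ _
    have hag : (a : ℤ) ≤ -P 2 := by
      have : a ≤ (-P 2).toNat := min_le_right _ _
      have : (a : ℤ) ≤ ((-P 2).toNat : ℤ) := by exact_mod_cast this
      omega
    have ha1 : 1 ≤ a := by
      rw [ha_def, le_min_iff]; refine ⟨hA1, ?_⟩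
      have : (1 : ℤ) ≤ ((-P 2).toNat : ℤ) := by omega
      exact_mod_cast this
    have hfull : a = Acap ∨ P 2 + a = tgt v R 2 := by
      by_cases h : Acap ≤ (-P 2).toNat
      · exact Or.inl (by rw [ha_def, min_eq_left h])
      · right
        have : a = (-P 2).toNat := by rw [ha_def, min_eq_right (by omega)]
        have : (a : ℤ) = -P 2 := by rw [this]; exact hgap
        omega
    have ha2 : P 2 + a ≤ 0 := by omega
    -- cap: `K·T(a) ≤ K(2A+3) ≤ τN ≤ τH`
    have hTa : Tmove a ≤ 2 * Acap + 3 := by unfold Tmove; omega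
    have haT : K * ((Tmove a : ℕ) : ℝ) ≤ τ * hgt v P := by
      have h1 : ((Tmove a : ℕ) : ℝ) ≤ 2 * (Acap : ℝ) + 3 := by exact_mod_cast hTa
      nlinarith
    have hd := centre_datum hv2 hκ hv0 hv1 hvK hτ hCD hΛ A π hπ hP hP2.le hlo hslack hN haT hQ
    have hd' : Datum D Λ p' Mw (α₂ * A.α ^ 2) k P (P + (a : ℤ) • (Pi.single 2 1 : Site 3)) :=
      datum_weaken hqc le_rfl (by omega) hd
    -- the new point lies in `𝕂` (the port of the frame)
    have hTa' : (a : ℤ) ≤ (Tmove a : ℤ) := by unfold Tmove; push_cast; omega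
    have e1 : (![0, (a : ℤ), 0] : Site 3) 1 = a := rfl
    have e2 : (![0, (a : ℤ), 0] : Site 3) 2 = 0 := rfl
    have hmem := (frame_mem_c hv2 hκ hv0 hv1 hvK hτ hCD π hπ hP hP2.le hlo hslack haT (y := ![0, (a : ℤ), 0]) (by simp)
      (by rw [e1]; exact ⟨by positivity, hTa'⟩) (by rw [e2]; exact ⟨le_rfl, by positivity⟩)).2
    rw [frame_port, hπ] at hmem
    refine ⟨_, hd', inv_centre hv2 hκ hv0 hv1 ⟨hP, hslack, hN, hM⟩ ha2 hmem, ?_⟩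
    -- potential
    have hco : ∀ j, (P + (a : ℤ) • (Pi.single 2 1 : Site 3)) j = P j + if j = 2 then (a : ℤ) else 0 := fun j => raise_apply P 2 a j
    have hmove := gapA_move Acap (T := tgt v R 2) (P := P 2) ha1 (by omega) hfull
    unfold pot
    rw [hco 0, hco 1, hco 2, if_neg (by decide), if_neg (by decide), if_pos rfl, add_zero, add_zero]
    linarith
  · -- RAISE MOVE (`P₂ = 0`)
    have hP20 : P 2 = 0 := le_antisymm (by rw [← ht2]; exact hM 2) (not_lt.1 hP2)
    obtain ⟨π, hπ, hlo, hlt⟩ := exists_rframe hv2 hκ hv0 hv1 hM hP20 hne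
    set a : ℕ := min Acap (tgt v R (π 1) - P (π 1)).toNat with ha_def
    have hgap : ((tgt v R (π 1) - P (π 1)).toNat : ℤ) = tgt v R (π 1) - P (π 1) := Int.toNat_of_nonneg (by omega)
    have haA : a ≤ Acap := min_le_left _ _
    have hag : (a : ℤ) ≤ tgt v R (π 1) - P (π 1) := by
      have : a ≤ (tgt v R (π 1) - P (π 1)).toNat := min_le_right _ _
      have : (a : ℤ) ≤ ((tgt v R (π 1) - P (π 1)).toNat : ℤ) := by exact_mod_cast this
      omega
    have ha1 : 1 ≤ a := by
      rw [ha_def, le_min_iff]; refine ⟨hA1, ?_⟩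
      have : (1 : ℤ) ≤ ((tgt v R (π 1) - P (π 1)).toNat : ℤ) := by omega
      exact_mod_cast this
    have hfull : a = Acap ∨ P (π 1) + a = tgt v R (π 1) := by
      by_cases h : Acap ≤ (tgt v R (π 1) - P (π 1)).toNat
      · exact Or.inl (by rw [ha_def, min_eq_left h])
      · right
        have : a = (tgt v R (π 1) - P (π 1)).toNat := by rw [ha_def, min_eq_right (by omega)]
        have : (a : ℤ) = tgt v R (π 1) - P (π 1) := by rw [this]; exact hgap
        omega
    -- cap: `K(a + ⌊a/m⌋) ≤ K·2a ≤ K(2A+3) ≤ τN ≤ τH`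
    have hTa : a + a / m ≤ 2 * Acap + 3 := by have := Nat.div_le_self a m; omega
    have haT : K * ((a + a / m : ℕ) : ℝ) ≤ τ * hgt v P := by
      have h1 : ((a + a / m : ℕ) : ℝ) ≤ 2 * (Acap : ℝ) + 3 := by exact_mod_cast hTa
      nlinarith
    have hd := raise_datum₂ hv2 hκ hv0 hv1 hvK hτ hCD hΛ A hm hmK hα₂ harm π hπ hP hlo hslack hN haT hQ
    have hd' : Datum D Λ p' Mw (α₂ * A.α ^ 2) k P (P + (a : ℤ) • (Pi.single (π 1) 1 : Site 3)) :=
      datum_weaken hqr le_rfl (by omega) hd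
    have hTa' : (a : ℤ) ≤ ((a + a / m : ℕ) : ℤ) := by exact_mod_cast Nat.le_add_right a (a / m)
    have hT0 : (0 : ℤ) ≤ ((a + a / m : ℕ) : ℤ) := by positivity
    have e1 : (![0, (a : ℤ), 0] : Site 3) 1 = a := rfl
    have e2 : (![0, (a : ℤ), 0] : Site 3) 2 = 0 := rfl
    have hmem := (frame_mem₂ hv2 hκ hv0 hv1 hvK hτ hCD π hπ hP hlo hslack haT (y := ![0, (a : ℤ), 0]) (by simp)
      (by rw [e1]; exact ⟨by positivity, hTa'⟩) (by rw [e2]; exact ⟨le_rfl, hT0⟩)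
      (by rw [e1, e2]; push_cast; rw [mul_zero]; exact mul_nonneg (hvn _) (by positivity))).2
    rw [frame_port] at hmem
    refine ⟨_, hd', inv_raise₀ hv2 hκ hv0 hv1 hvK hτ hcapS ⟨hP, hslack, hN, hM⟩ π hπ hlo haA (by omega) hmem, ?_⟩
    have hco : ∀ j, (P + (a : ℤ) • (Pi.single (π 1) 1 : Site 3)) j = P j + if j = π 1 then (a : ℤ) else 0 :=
      fun j => raise_apply P (π 1) a j
    have hmove := gapA_move Acap (T := tgt v R (π 1)) (P := P (π 1)) ha1 (by omega) hfull
    have e : ∀ j, j ≠ π 1 → gapA Acap (tgt v R j) ((P + (a : ℤ) • (Pi.single (π 1) 1 : Site 3)) j) = gapA Acap (tgt v R j) (P j) :=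
      fun j hj => by rw [hco j, if_neg hj, add_zero]
    have e1' : gapA Acap (tgt v R (π 1)) ((P + (a : ℤ) • (Pi.single (π 1) 1 : Site 3)) (π 1)) + Acap ≤ gapA Acap (tgt v R (π 1)) (P (π 1)) := by
      rw [hco (π 1), if_pos rfl]; exact hmove
    unfold pot
    generalize hl : π 1 = l at e e1' ⊢
    fin_cases l
    · have f1 := e 1 (by decide); have f2 := e 2 (by decide)
      simp only [Fin.zero_eta, Fin.isValue] at e1' f1 f2 ⊢; linarith
    · have f0 := e 0 (by decide); have f2 := e 2 (by decide)
      simp only [Fin.mk_one, Fin.isValue] at e1' f0 f2 ⊢; linarith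
    · have f0 := e 0 (by decide); have f1 := e 1 (by decide)
      simp only [Fin.reduceFinMk, Fin.isValue] at e1' f0 f1 ⊢; linarith

include hv2 hκ hv0 hv1 hvK hτ hh hCD in
/-- **THE SCHEDULE.**  Under the hypotheses of `step₀`: if `P` is invariant with `Ψ(P) < (n+1)A` then `n` moves reach the station `⌈Rv⌉`,
probability `(α₂α²)ⁿ`, `n·k` extra edges. [cite: AizenmanChayesChayesFrohlichRusso1983, §4 Cor. to Lemma 4.3] -/
theorem schedule₀ {N : ℕ} {Λ : Set (Site 3)} (hΛ : ∀ x ∈ Λ, hgt v x ≤ (N : ℝ)) {p' : unitInterval} (A : SlabArmKit k p')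
    {m : ℕ} (hm : 1 ≤ m) (hmK : K ≤ (m : ℝ) * κ) {α₂ : ℝ} (hα₂ : 0 < α₂)
    (harm : ∀ b : Site 3, b ∈ slab 3 k →
      α₂ ≤ (bondPercolation (zdGraph 3) p').real (percolatesVia (withinGraph (zdGraph 3) (steepSetM (2 * m) k 1 b)) b))
    {R : ℝ} (hR0 : 0 ≤ R) {Acap Mw : ℕ} (hA1 : 1 ≤ Acap) (hcapS : ((Acap : ℝ) + k) * K ≤ τ * N)
    (hcapT : K * (2 * (Acap : ℝ) + 3) ≤ τ * N) (hMw : 2 * Acap + 3 + k + winQ₀ v τ K R ≤ Mw) :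
    ∀ n : ℕ, ∀ P : Site 3, Inv D v τ K k N R P → pot v R Acap P < (n + 1) * Acap →
      Datum D Λ p' Mw ((α₂ * A.α ^ 2) ^ n) (n * k) P (tgt v R) := by
  have hq1 : α₂ * A.α ^ 2 ≤ 1 := by
    have h1 : α₂ ≤ 1 := (harm 0 (zero_mem_slab 3 k)).trans measureReal_le_one
    have h2 : A.α ≤ 1 := (A.shallow_arm 0 (zero_mem_slab 3 k)).trans measureReal_le_one
    have h3 : A.α ^ 2 ≤ 1 := pow_le_one₀ A.α_pos.le h2
    exact mul_le_one₀ h1 (by positivity) h3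
  have hq0 : 0 ≤ α₂ * A.α ^ 2 := by have := A.α_pos; positivity
  intro n; induction n with
  | zero =>
    intro P hI hpot
    have hM := hI.2.2.2
    have g0 := gapA_props Acap (hM 0); have g1 := gapA_props Acap (hM 1); have g2 := gapA_props Acap (hM 2)
    unfold pot at hpot
    have hpot' : gapA Acap (tgt v R 0) (P 0) + gapA Acap (tgt v R 1) (P 1) + gapA Acap (tgt v R 2) (P 2) < Acap := by
      simpa using hpot
    have hPΩ : P = tgt v R := by
      have a0 := g0.2 (by omega); have a1 := g1.2 (by omega); have a2 := g2.2 (by omega)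
      funext j; fin_cases j; exacts [a0, a1, a2]
    rw [hPΩ]
    simpa using datum_refl D Λ p' Mw (tgt v R)
  | succ n ih =>
    intro P hI hpot
    by_cases hPΩ : P = tgt v R
    · rw [hPΩ]
      exact datum_weaken (pow_le_one₀ hq0 hq1) (Nat.zero_le _) le_rfl (datum_refl D Λ p' Mw (tgt v R))
    · obtain ⟨P', hd, hI', hdrop⟩ := step₀ hv2 hκ hv0 hv1 hvK hτ hh hCD hΛ A hm hmK hα₂ harm hR0 hA1 hcapS hcapT hMw hI hPΩ
      have hpot' : pot v R Acap P' < (n + 1) * Acap := by push_cast at hpot ⊢; linarith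
      have h₂ := ih P' hI' hpot'
      have h := datum_chain hq0 hd h₂
      rw [← pow_succ', show k + n * k = (n + 1) * k by ring] at h
      exact h

end Cone

end PWCone

end Summit.CriticalPhenomena.PercolationContinuityZ3.Theorems.Transplant

end
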